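import Mathlib
import HarnessLib

/-!
# Crux `ShallowShadows.ShadowFormulaTransfer` (stmt-ValiantsHypothesis-17124), line `Sketch` —
# the registered stub `stub_gridRigidity` (the `T = 2` grid polynomial is never `0/1`)

On the `D × D` grid of variables `X_{(π, κ)}` take the row forms `U_π = Σ_κ c_{πκ} X_{(π,κ)}`
and the column forms `V_κ = Σ_π c'_{πκ} X_{(π,κ)}` with all coefficients nonzero, and
`g = α Π_π U_π + β Π_κ V_κ` with `α, β ≠ 0`. For `D ≥ 3` some coefficient of `g` is neither `0`
nor `1` (`stub_gridRigidity`). (For `D = 2` this fails: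
`(x₀₀ + x₀₁)(x₁₀ + x₁₁) + (x₀₀ - x₁₀)(x₀₁ - x₁₁) = x₀₀x₁₀ + x₀₁x₁₁ + x₀₀x₀₁ + x₁₀x₁₁`.)

PROOF. Expanding `Π_i Σ_k a_{ik} X_{e(i,k)}` (`Fintype.prod_sum`) gives
`Σ_{g : i ↦ k} (Π_i a_{i, g i}) X^{v_g}` with the exponent vector `v_g = Σ_i δ_{e(i, g i)}`
(`grid_prod_sum_smul_X`, `grid_coeff_prod_sum_smul_X`). For a cell map `e` injective in the
pair `(i, k)` one has `v_g (e(i,k)) = [g i = k]` (`grid_expVec_apply`), so distinct `g` have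
distinct exponent vectors (`grid_expVec_injective`) and the coefficient of `X^{v_f}` is
`Π_i a_{i, f i}` (`grid_coeff_expVec`). A row vector `v_f` (cells `(π, f π)`) equals a column
vector `w_h` (cells `(h κ, κ)`) only if `h ∘ f = id` (`grid_leftInverse_of_expVec_eq`), so at
the exponent vector of a NON-injective row function `f` the column product contributes nothing
(`grid_coeff_expVec_cross`) and `coeff_{v_f} g = α Π_π c_{π, f π} ≠ 0`; symmetrically for
non-injective column functions. Were every coefficient of `g` in `{0, 1}`, then
`α Π_π c_{π, f π} = 1` for every non-injective `f`. With three distinct indices `i₀, i₁, i₂`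
(`D ≥ 3`) the non-injective functions `f₀ = [i₁, i₂ ↦ i₀]`, `f' = [i₂ ↦ i₀]`, `f'' = [i₁ ↦ i₀]`
(identity elsewhere) satisfy, row by row,
`Π_π c_{ππ} · Π_π c_{π, f₀ π} = Π_π c_{π, f' π} · Π_π c_{π, f'' π}`, whence `α Π_π c_{ππ} = 1`
(`grid_prod_diag_eq_one`); likewise `β Π_κ c'_{κκ} = 1`, and the coefficient of the diagonal
monomial `Π_π X_{(π,π)}` — the row AND the column exponent vector of the identity — is
`1 + 1 = 2 ∉ {0, 1}`.
-/

-- Sub = Summit single-conjunct layout: the duplicated namespace component is mandated by the tree.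
set_option linter.dupNamespace false

noncomputable section

namespace Summit.ValiantsHypothesis.ValiantsHypothesis.Theorems.ShallowShadowsShadowFormulaTransfer

open MvPolynomial

/-! ### Products of linear forms in blocks of variables: monomial expansion -/

/-- Expansion of a product of linear forms placed by a cell map `e`:
`Π_i Σ_k a_{ik} X_{e(i,k)} = Σ_{g : i ↦ k} (Π_i a_{i, g i}) · X^{Σ_i δ_{e(i, g i)}}`. [folklore] -/
theorem grid_prod_sum_smul_X {ι κ τ R : Type*} [Fintype ι] [Fintype κ] [DecidableEq ι]
    [CommSemiring R] (a : ι → κ → R) (e : ι → κ → τ) :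
    ∏ i, ∑ k, a i k • (X (e i k) : MvPolynomial τ R) =
      ∑ g : ι → κ, (∏ i, a i (g i)) • monomial (∑ i, Finsupp.single (e i (g i)) 1) 1 := by
  rw [Fintype.prod_sum]
  refine Finset.sum_congr rfl fun g _ => ?_
  rw [Finset.prod_smul, monomial_sum_one]
  rfl

/-- The coefficients of `Π_i Σ_k a_{ik} X_{e(i,k)}`: the coefficient at `m` collects the
products `Π_i a_{i, g i}` over the `g` with exponent vector `Σ_i δ_{e(i, g i)} = m`. [folklore] -/
theorem grid_coeff_prod_sum_smul_X {ι κ τ R : Type*} [Fintype ι] [Fintype κ] [DecidableEq ι]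
    [DecidableEq τ] [CommSemiring R] (a : ι → κ → R) (e : ι → κ → τ) (m : τ →₀ ℕ) :
    coeff m (∏ i, ∑ k, a i k • (X (e i k) : MvPolynomial τ R)) =
      ∑ g : ι → κ, if (∑ i, Finsupp.single (e i (g i)) 1) = m then ∏ i, a i (g i) else 0 := by
  rw [grid_prod_sum_smul_X, coeff_sum]
  refine Finset.sum_congr rfl fun g _ => ?_
  rw [coeff_smul, coeff_monomial, smul_eq_mul, mul_ite, mul_one, mul_zero]

/-- For a cell map `e` injective in the pair `(i, k)`, the exponent vector `Σ_i δ_{e(i, g i)}`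
takes the value `[g i₀ = k₀]` at the cell `e(i₀, k₀)`. [folklore] -/
theorem grid_expVec_apply {ι κ τ : Type*} [Fintype ι] [DecidableEq κ] {e : ι → κ → τ}
    (he : Function.Injective2 e) (g : ι → κ) (i₀ : ι) (k₀ : κ) :
    (∑ i, Finsupp.single (e i (g i)) (1 : ℕ)) (e i₀ k₀) = if g i₀ = k₀ then 1 else 0 := by
  classical
  rw [Finsupp.finsetSum_apply, Fintype.sum_eq_single i₀]
  · rw [Finsupp.single_apply]
    exact if_congr (he.eq_iff.trans (and_iff_right rfl)) rfl rfl
  · intro i hi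
    rw [Finsupp.single_apply, if_neg fun h => hi (he h).1]

/-- For a cell map `e` injective in the pair `(i, k)`, distinct `g : ι → κ` have distinct
exponent vectors `Σ_i δ_{e(i, g i)}`. [folklore] -/
theorem grid_expVec_injective {ι κ τ : Type*} [Fintype ι] {e : ι → κ → τ}
    (he : Function.Injective2 e) {g g' : ι → κ}
    (h : (∑ i, Finsupp.single (e i (g i)) (1 : ℕ)) = ∑ i, Finsupp.single (e i (g' i)) 1) :
    g = g' := by
  classical
  funext i
  have h1 := grid_expVec_apply he g' i (g i)
  rw [← h, grid_expVec_apply he g i (g i), if_pos rfl] at h1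
  by_contra hne
  rw [if_neg (Ne.symm hne)] at h1
  exact one_ne_zero h1

/-- The coefficient of `Π_i Σ_k a_{ik} X_{e(i,k)}` at the exponent vector of `f : ι → κ` is
`Π_i a_{i, f i}` (cell map `e` injective in the pair). [folklore] -/
theorem grid_coeff_expVec {ι κ τ R : Type*} [Fintype ι] [Fintype κ] [CommSemiring R]
    {e : ι → κ → τ} (he : Function.Injective2 e) (a : ι → κ → R) (f : ι → κ) :
    coeff (∑ i, Finsupp.single (e i (f i)) 1) (∏ i, ∑ k, a i k • (X (e i k) : MvPolynomial τ R)) =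
      ∏ i, a i (f i) := by
  classical
  rw [grid_coeff_prod_sum_smul_X, Fintype.sum_eq_single f, if_pos rfl]
  intro g hg
  exact if_neg fun h => hg (grid_expVec_injective he h)

/-- A row exponent vector (cells `e(i, g i)`) equals a column exponent vector (cells
`e'(k, h k)`, where `e(i,k) = e'(k,i)`) only along a one-sided inverse: `h (g i) = i`.
[folklore] -/
theorem grid_leftInverse_of_expVec_eq {ι κ τ : Type*} [Fintype ι] [Fintype κ]
    {e : ι → κ → τ} {e' : κ → ι → τ} (he : Function.Injective2 e)
    (he' : Function.Injective2 e') (hee' : ∀ i k, e i k = e' k i) {g : ι → κ} {h : κ → ι}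
    (H : (∑ i, Finsupp.single (e i (g i)) (1 : ℕ)) = ∑ k, Finsupp.single (e' k (h k)) 1) :
    Function.LeftInverse h g := by
  classical
  intro i
  have h1 := grid_expVec_apply he g i (g i)
  rw [if_pos rfl, H, hee', grid_expVec_apply he' h (g i) i] at h1
  by_contra hne
  rw [if_neg hne] at h1
  exact zero_ne_one h1

/-- At the exponent vector of a NON-injective `g : ι → κ` (cells `e(i, g i)`), the transposed
product `Π_k Σ_i a_{ki} X_{e'(k,i)}` (`e(i,k) = e'(k,i)`) has coefficient `0`: its exponent
vectors are those of column functions `h`, and `v_g = w_h` would force `h ∘ g = id`.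
[folklore] -/
theorem grid_coeff_expVec_cross {ι κ τ R : Type*} [Fintype ι] [Fintype κ] [CommSemiring R]
    {e : ι → κ → τ} {e' : κ → ι → τ} (he : Function.Injective2 e)
    (he' : Function.Injective2 e') (hee' : ∀ i k, e i k = e' k i) (a : κ → ι → R) {g : ι → κ}
    (hg : ¬ Function.Injective g) :
    coeff (∑ i, Finsupp.single (e i (g i)) 1)
      (∏ k, ∑ i, a k i • (X (e' k i) : MvPolynomial τ R)) = 0 := by
  classical
  rw [grid_coeff_prod_sum_smul_X]
  refine Finset.sum_eq_zero fun h _ => if_neg fun H => hg ?_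
  exact (grid_leftInverse_of_expVec_eq he he' hee' H.symm).injective

/-! ### Three rows suffice -/

/-- If `α Π_π a_{π, f π} = 1` for every non-injective `f : Fin D → Fin D` and `D ≥ 3`, then also
`α Π_π a_{ππ} = 1`: for distinct `i₀ i₁ i₂` the non-injective `f₀ = [i₁, i₂ ↦ i₀]`,
`f' = [i₂ ↦ i₀]`, `f'' = [i₁ ↦ i₀]` (identity elsewhere) satisfy
`Π_π a_{ππ} · Π_π a_{π, f₀ π} = Π_π a_{π, f' π} · Π_π a_{π, f'' π}` factor by factor. [folklore] -/
theorem grid_prod_diag_eq_one {D : ℕ} (hD : 3 ≤ D) (a : Fin D → Fin D → ℂ) (α : ℂ)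
    (h : ∀ f : Fin D → Fin D, ¬ Function.Injective f → α * ∏ π, a π (f π) = 1) :
    α * ∏ π, a π π = 1 := by
  obtain ⟨i₀, i₁, i₂, h01, h02, h12⟩ : ∃ i₀ i₁ i₂ : Fin D, i₀ ≠ i₁ ∧ i₀ ≠ i₂ ∧ i₁ ≠ i₂ :=
    ⟨⟨0, by omega⟩, ⟨1, by omega⟩, ⟨2, by omega⟩, Fin.ne_of_val_ne (by norm_num),
      Fin.ne_of_val_ne (by norm_num), Fin.ne_of_val_ne (by norm_num)⟩
  have key : (∏ π, a π π) * ∏ π, a π (if π = i₁ ∨ π = i₂ then i₀ else π) =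
      (∏ π, a π (if π = i₂ then i₀ else π)) * ∏ π, a π (if π = i₁ then i₀ else π) := by
    rw [← Finset.prod_mul_distrib, ← Finset.prod_mul_distrib]
    refine Finset.prod_congr rfl fun π _ => ?_
    by_cases h1 : π = i₁
    · rw [if_pos (Or.inl h1), if_pos h1, if_neg fun h2 => h12 (h1.symm.trans h2)]
    · by_cases h2 : π = i₂
      · rw [if_pos (Or.inr h2), if_pos h2, if_neg h1, mul_comm]
      · rw [if_neg (not_or.mpr ⟨h1, h2⟩), if_neg h1, if_neg h2]
  have n0 : ¬ Function.Injective fun π : Fin D => if π = i₁ ∨ π = i₂ then i₀ else π :=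
    fun hinj => h12 (hinj (by simp))
  have n1 : ¬ Function.Injective fun π : Fin D => if π = i₂ then i₀ else π :=
    fun hinj => h02 (hinj (by simp))
  have n2 : ¬ Function.Injective fun π : Fin D => if π = i₁ then i₀ else π :=
    fun hinj => h01 (hinj (by simp))
  have e0 : α * ∏ π, a π (if π = i₁ ∨ π = i₂ then i₀ else π) = 1 := h _ n0
  have e1 : α * ∏ π, a π (if π = i₂ then i₀ else π) = 1 := h _ n1
  have e2 : α * ∏ π, a π (if π = i₁ then i₀ else π) = 1 := h _ n2
  linear_combination α ^ 2 * key - (α * ∏ π, a π π) * e0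
    + (α * ∏ π, a π (if π = i₁ then i₀ else π)) * e1 + e2

/-! ### The registered stub -/

/-- Stub GridRigidity: on the `D × D` grid (`D ≥ 3`), `α Π_π (Σ_κ c_{πκ} X_{πκ}) +
β Π_κ (Σ_π c'_{πκ} X_{πκ})` with `α, β` and all `c, c'` nonzero has a coefficient outside
`{0, 1}`: at the exponent vector of a non-injective row (column) function only the row (column)
product contributes, forcing `α Π_π c_{π, f π} = 1` (`β Π_κ c'_{h κ, κ} = 1`) throughout, hence
(`grid_prod_diag_eq_one`) `α Π_π c_{ππ} = β Π_κ c'_{κκ} = 1` and the diagonal monomial has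
coefficient `2`. [folklore] -/
theorem stub_gridRigidity :
    ∀ (D : ℕ), 3 ≤ D → ∀ (α β : ℂ) (c c' : Fin D → Fin D → ℂ), α ≠ 0 → β ≠ 0 →
      (∀ π κ, c π κ ≠ 0) → (∀ π κ, c' π κ ≠ 0) →
      ∃ m : Fin D × Fin D →₀ ℕ,
        (α • ∏ π : Fin D, (∑ κ : Fin D, c π κ • (MvPolynomial.X (π, κ) : MvPolynomial (Fin D × Fin D) ℂ)) +
          β • ∏ κ : Fin D, (∑ π : Fin D, c' π κ •
            (MvPolynomial.X (π, κ) : MvPolynomial (Fin D × Fin D) ℂ))).coeff m ≠ 0 ∧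
        (α • ∏ π : Fin D, (∑ κ : Fin D, c π κ • (MvPolynomial.X (π, κ) : MvPolynomial (Fin D × Fin D) ℂ)) +
          β • ∏ κ : Fin D, (∑ π : Fin D, c' π κ •
            (MvPolynomial.X (π, κ) : MvPolynomial (Fin D × Fin D) ℂ))).coeff m ≠ 1 := by
  intro D hD α β c c' hα hβ hc hc'
  -- the row and the column cell maps `(π, κ) ↦ (π, κ)` and `(κ, π) ↦ (π, κ)`
  have he : Function.Injective2 fun π κ : Fin D => (π, κ) := fun _ _ _ _ h => Prod.mk_inj.1 h
  have he' : Function.Injective2 fun κ π : Fin D => (π, κ) := fun _ _ _ _ h =>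
    (Prod.mk_inj.1 h).symm
  set P : MvPolynomial (Fin D × Fin D) ℂ := ∏ π : Fin D, ∑ κ : Fin D, c π κ • X (π, κ)
  set Q : MvPolynomial (Fin D × Fin D) ℂ := ∏ κ : Fin D, ∑ π : Fin D, c' π κ • X (π, κ)
  have rowP : ∀ f : Fin D → Fin D, coeff (∑ π, Finsupp.single (π, f π) 1) P = ∏ π, c π (f π) :=
    fun f => grid_coeff_expVec he c f
  have rowQ : ∀ f : Fin D → Fin D, ¬ Function.Injective f →
      coeff (∑ π, Finsupp.single (π, f π) 1) Q = 0 :=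
    fun f hf => grid_coeff_expVec_cross he he' (fun _ _ => rfl) (fun κ π => c' π κ) hf
  have colQ : ∀ h : Fin D → Fin D,
      coeff (∑ κ, Finsupp.single (h κ, κ) 1) Q = ∏ κ, c' (h κ) κ :=
    fun h => grid_coeff_expVec he' (fun κ π => c' π κ) h
  have colP : ∀ h : Fin D → Fin D, ¬ Function.Injective h →
      coeff (∑ κ, Finsupp.single (h κ, κ) 1) P = 0 :=
    fun h hh => grid_coeff_expVec_cross he' he (fun _ _ => rfl) c hh
  have hg : ∀ m, coeff m (α • P + β • Q) = α * coeff m P + β * coeff m Q := fun m => by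
    rw [coeff_add, coeff_smul, coeff_smul, smul_eq_mul, smul_eq_mul]
  by_contra hcon
  push Not at hcon
  -- (i) rows: at a non-injective row function only the row product contributes
  have rows : ∀ f : Fin D → Fin D, ¬ Function.Injective f → α * ∏ π, c π (f π) = 1 := by
    intro f hf
    have h1 := hcon (∑ π, Finsupp.single (π, f π) 1)
    rw [hg, rowP f, rowQ f hf, mul_zero, add_zero] at h1
    exact h1 (mul_ne_zero hα (Finset.prod_ne_zero_iff.mpr fun π _ => hc π (f π)))
  -- (ii) columns
  have cols : ∀ h : Fin D → Fin D, ¬ Function.Injective h → β * ∏ κ, c' (h κ) κ = 1 := by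
    intro h hh
    have h1 := hcon (∑ κ, Finsupp.single (h κ, κ) 1)
    rw [hg, colP h hh, colQ h, mul_zero, zero_add] at h1
    exact h1 (mul_ne_zero hβ (Finset.prod_ne_zero_iff.mpr fun κ _ => hc' (h κ) κ))
  -- (iii) the diagonal monomial has coefficient `1 + 1`
  have hid₁ : α * ∏ π, c π π = 1 := grid_prod_diag_eq_one hD c α rows
  have hid₂ : β * ∏ κ, c' κ κ = 1 := grid_prod_diag_eq_one hD (fun κ π => c' π κ) β cols
  have h2 := hcon (∑ π, Finsupp.single (π, π) 1)
  rw [hg, rowP fun π => π, colQ fun κ => κ, hid₁, hid₂] at h2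
  norm_num at h2

end Summit.ValiantsHypothesis.ValiantsHypothesis.Theorems.ShallowShadowsShadowFormulaTransfer

end
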